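import Literature.Probability.LatticeModels.FKPrimitiveLaplacian
import HarnessLib

/-!
# The boundary-modified Laplacian of the FK primitive (Duminil-Copin–Hongler–Nolin's boundary trick)

Topic `Literature/Probability/LatticeModels`; an instalment of the Russo–Seymour–Welsh programme
for the critical FK-Ising model (`FKIsingRSW.lean`, fact `fkIsing_rsw`) after H. Duminil-Copin,
C. Hongler, P. Nolin, *Connection probabilities and RSW-type bounds for the two-dimensional FK
Ising model*, Comm. Pure Appl. Math. 64 (2011), arXiv:0912.4253 (DCHN), built on the tree's
rendering of Smirnov's observable (`DartFlux.lean`, `FKPrimitiveLaplacian.lean`).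

`FKPrimitiveLaplacian.lean` proves Smirnov's Lemma 3.8 — the discrete primitive `(Hw, Hb)` of the
critical FK-Ising observable is superharmonic on sites and subharmonic on faces — at sites (faces)
all four of whose edges (sides) are *interior*. DCHN's comparison of `H` with harmonic measures
(§3.1, Proposition 8) needs an inequality also at the squares *next to the boundary arcs*, where
one of the medial vertices involved is a boundary vertex and the observable is not s-holomorphic.
Their device (proof of Proposition 8, "a variation of a trick introduced in [CS2]"): extend `F`
across the boundary vertex to the two medial edges outside by requiring the projection relations
to hold, so that Smirnov's Appendix C computation applies verbatim, and evaluate the resulting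
*phantom* flux: `|F(e₃)|² = tan²(π/8) |F(e₂)|²`. This file carries this out for the tree's objects,
in both colours and for any number of boundary edges at the square:

* `quarterPhase_one`, `quarterPhase_neg_one` (`e^{∓iπ/4} = (1 ∓ i)/√2`),
  `quarterPhase_dartDir_add_one/three` (consecutive darts at a vertex carry lines an eighth turn
  apart); `blackPhantom`, `whitePhantom` (the phantom vectors `c (1 ± (√2-1) i) w`) with their
  three projections (`projLine_*Phantom_self/turn`, `norm_projLine_*Phantom_perp_sq`: the phantom
  flux is `(√2-1)² = tan²(π/8)` times the real one).
* **`phantom_laplacian_hb`** (faces with sides on the wired arc `A`, forced-open edges,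
  `dartObs_follow_of_forall_mem`): for an inner face `f` whose sides are interior or `A`–`A` edges
  (set `P`), `∑_{j∉P} (Hb(f_j) - Hb(f)) - (1 - tan²(π/8)) ∑_{j∈P} (Hb(f) - Hw(a_j)) ≥ 0`.
* **`phantom_laplacian_hw`** (sites next to the free arc `B`, forced-closed edges,
  `dartObs_cross_of_forall_not_mem`): for a site `u` with four inner faces whose edges are interior
  or lead to `B` (set `P`),
  `∑_{k∉P} (Hw(u+e_k) - Hw(u)) + (1 - tan²(π/8)) ∑_{k∈P} (Hw(u+e_k) - Hw(u)) ≤ 0` — DCHN's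
  eq. (modified_laplacian) for `H_• = 1 - Hw` (their extra layer of black faces along the free arc
  is the tree's arc `B` itself, on which `Hw` is constant and one above the wired level).

In both cases the primitive is sub/super-harmonic for a nearest-neighbour operator with weight
`1` towards ordinary neighbours and `1 - tan²(π/8) = 2(√2-1)` towards the boundary (phantom)
neighbours, whose value is the arc level; with the maximum principle for such weighted operators
this is DCHN's Proposition 8 (uniform comparability). Everything here is proved; no named fact is
introduced.

## References

* H. Duminil-Copin, C. Hongler, P. Nolin, *Connection probabilities and RSW-type bounds for the
  two-dimensional FK Ising model*, Comm. Pure Appl. Math. 64 (2011) 1165–1198, §3.1,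
  Proposition 8 and eq. (modified_laplacian) — bib key `DuminilCopinHonglerNolin2011`.
* S. Smirnov, *Conformal invariance in random cluster models. I*, Ann. of Math. 172 (2010):
  Lemma 3.8, Appendix C, Lemma 4.1, Lemma 4.11 — bib key `Smirnov2010`.
-/

noncomputable section

namespace Literature.Probability.LatticeModels

open Finset Complex ComplexConjugate

/-! ### Quarter-turn phases: explicit values and one-step shifts of the dart lines -/

/-- `quarterPhase (-1) = e^{iπ/4} = (1 + i)/√2`. [cite: Smirnov2010, §4] -/
theorem quarterPhase_neg_one : quarterPhase (-1) = (1 + I) / Real.sqrt 2 := by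
  have hs : (Real.sqrt 2 : ℂ) ≠ 0 := by exact_mod_cast (Real.sqrt_pos.2 two_pos).ne'
  rw [quarterPhase_eq_eighthPhase, show (2 : ℤ) * -1 = -2 by norm_num, eq_div_iff hs, mul_comm]
  exact sqrt_two_mul_eighthPhase_neg_two

/-- `quarterPhase 1 = e^{-iπ/4} = (1 - i)/√2`. [cite: Smirnov2010, §4] -/
theorem quarterPhase_one : quarterPhase 1 = (1 - I) / Real.sqrt 2 := by
  have hs : (Real.sqrt 2 : ℂ) ≠ 0 := by exact_mod_cast (Real.sqrt_pos.2 two_pos).ne'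
  have hs2 : (Real.sqrt 2 : ℂ) * Real.sqrt 2 = 2 := by
    rw [← Complex.ofReal_mul, Real.mul_self_sqrt zero_le_two]; norm_num
  have h := quarterPhase_add 1 (-1)
  rw [show (1 : ℤ) + -1 = 0 by norm_num, show quarterPhase 0 = 1 by simp [quarterPhase], quarterPhase_neg_one] at h
  have h1 : quarterPhase 1 * (1 + I) = Real.sqrt 2 := by
    rw [mul_div_assoc'] at h
    exact (div_eq_one_iff_eq hs).1 h.symm
  have hI : (1 + I : ℂ) ≠ 0 := by intro h0; have := congrArg Complex.re h0; simp at this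
  rw [eq_div_iff hs]
  refine mul_right_cancel₀ hI ?_
  rw [mul_assoc, mul_comm (Real.sqrt 2 : ℂ) (1 + I), ← mul_assoc, h1, hs2]
  rw [show (1 - I) * (1 + I) = 1 - I * I by ring, I_mul_I]; norm_num

/-- **One step around a vertex turns the dart line by an eighth turn**: if `q'.2 = q.2 + 1` then
`quarterPhase (dartDir c₀ q') = ± e^{-iπ/4} · quarterPhase (dartDir c₀ q)`. [cite: Smirnov2010, Lemma 4.1] -/
theorem quarterPhase_dartDir_add_one (c₀ q q' : Site 2 × Fin 4) (h : q'.2 = q.2 + 1) :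
    quarterPhase (dartDir c₀ q') = quarterPhase 1 * quarterPhase (dartDir c₀ q) ∨
      quarterPhase (dartDir c₀ q') = -(quarterPhase 1 * quarterPhase (dartDir c₀ q)) := by
  unfold dartDir
  rw [h]
  have key : ((q.2 + 1 - c₀.2 : Fin 4) : ℕ) = ((q.2 - c₀.2 : Fin 4) : ℕ) + 1 ∨
      ((q.2 + 1 - c₀.2 : Fin 4) : ℕ) + 3 = ((q.2 - c₀.2 : Fin 4) : ℕ) := by
    have : q.2 + 1 - c₀.2 = (q.2 - c₀.2) + 1 := by abel
    rw [this]
    generalize q.2 - c₀.2 = d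
    fin_cases d <;> decide
  rcases key with key | key
  · left
    rw [key, Nat.cast_add, Nat.cast_one, quarterPhase_add]; ring
  · right
    have hd : ((q.2 - c₀.2 : Fin 4) : ℕ) = ((q.2 + 1 - c₀.2 : Fin 4) : ℕ) + 3 := key.symm
    rw [hd, Nat.cast_add, show ((3 : ℕ) : ℤ) = 3 by rfl, quarterPhase_add]
    have h4 : quarterPhase 1 * quarterPhase 3 = -1 := by
      rw [← quarterPhase_add, show (1 : ℤ) + 3 = 0 + 4 by norm_num, quarterPhase_add_four]
      simp [quarterPhase]
    rw [show quarterPhase 1 * (quarterPhase (((q.2 + 1 - c₀.2 : Fin 4) : ℕ) : ℤ) * quarterPhase 3) =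
      quarterPhase (((q.2 + 1 - c₀.2 : Fin 4) : ℕ) : ℤ) * (quarterPhase 1 * quarterPhase 3) by ring, h4]
    ring

/-- `quarterPhase 1 * quarterPhase (-1) = 1`. [cite: Smirnov2010, §4] -/
theorem quarterPhase_one_mul_neg_one : quarterPhase 1 * quarterPhase (-1) = 1 := by
  rw [← quarterPhase_add]; simp [quarterPhase]

/-- **Three steps (one step back)**: if `q'.2 = q.2 + 3` then
`quarterPhase (dartDir c₀ q') = ± e^{iπ/4} · quarterPhase (dartDir c₀ q)`. [cite: Smirnov2010, Lemma 4.1] -/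
theorem quarterPhase_dartDir_add_three (c₀ q q' : Site 2 × Fin 4) (h : q'.2 = q.2 + 3) :
    quarterPhase (dartDir c₀ q') = quarterPhase (-1) * quarterPhase (dartDir c₀ q) ∨
      quarterPhase (dartDir c₀ q') = -(quarterPhase (-1) * quarterPhase (dartDir c₀ q)) := by
  have h' : q.2 = q'.2 + 1 := by rw [h, add_assoc, show (3 : Fin 4) + 1 = 0 from rfl, add_zero]
  rcases quarterPhase_dartDir_add_one c₀ q' q h' with hq | hq
  · left
    rw [hq, ← mul_assoc, mul_comm (quarterPhase (-1)), quarterPhase_one_mul_neg_one, one_mul]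
  · right
    rw [hq, mul_neg, neg_neg, ← mul_assoc, mul_comm (quarterPhase (-1)), quarterPhase_one_mul_neg_one, one_mul]

/-! ### Projections onto unit lines; the phantom vectors -/

/-- The projection onto the line of a unit vector `w`: `Proj[X; w] = Re(X w̄) w`. [cite: ChelkakSmirnov2012, §3.2] -/
theorem projLine_of_norm_eq_one {w : ℂ} (hw : ‖w‖ = 1) (X : ℂ) :
    projLine w X = ((X * conj w).re : ℂ) * w := by
  rw [projLine_eq, hw, one_pow, div_one, Complex.real_smul]

/-- The squared length of the projection onto a unit line. [cite: ChelkakSmirnov2012, §3.2] -/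
theorem norm_projLine_sq_of_norm_eq_one {w : ℂ} (hw : ‖w‖ = 1) (X : ℂ) :
    ‖projLine w X‖ ^ 2 = (X * conj w).re ^ 2 := by
  rw [norm_projLine_sq (norm_ne_zero_iff.1 (by rw [hw]; exact one_ne_zero)), hw, one_pow, div_one]

/-- `w w̄ = 1` for a unit vector. [folklore] -/
private theorem mul_conj_of_norm_eq_one {w : ℂ} (hw : ‖w‖ = 1) : w * conj w = 1 := by
  rw [mul_conj', hw]; simp

/-- `(√2 : ℂ) ≠ 0`. [folklore] -/
private theorem sqrt_two_ne_zero' : (Real.sqrt 2 : ℂ) ≠ 0 := by exact_mod_cast (Real.sqrt_pos.2 two_pos).ne'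

/-- **The black phantom vector** at a boundary medial vertex, seen from the line `w` of the dart
arriving inside the face: `X = c (1 + (√2 - 1) i) w`. It projects to `c w` on `w`, to
`c e^{iπ/4} w` on the line `± e^{iπ/4} w` of the dart leaving after a right turn (a followed open
edge), and its squared projection onto the orthogonal line `± i w` — the flux into the phantom
face across the edge — is `tan²(π/8) c² = (√2 - 1)² c²`: Duminil-Copin–Hongler–Nolin's
computation `|F(e₃)|² = tan²(π/8) |F(e₂)|²` in the proof of Proposition 8.
[cite: DuminilCopinHonglerNolin2011, §3.1, proof of Proposition 8] -/
def blackPhantom (c : ℝ) (w : ℂ) : ℂ := (c : ℂ) * (1 + ((Real.sqrt 2 - 1 : ℝ) : ℂ) * I) * w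

/-- **The white phantom vector**: `X = c (1 - (√2 - 1) i) w`, for a left turn (a crossed closed
edge, the free arc). [cite: DuminilCopinHonglerNolin2011, §3.1, proof of Proposition 8] -/
def whitePhantom (c : ℝ) (w : ℂ) : ℂ := (c : ℂ) * (1 - ((Real.sqrt 2 - 1 : ℝ) : ℂ) * I) * w

section Phantom

variable {w : ℂ} (hw : ‖w‖ = 1) (c : ℝ)
include hw

/-- The black phantom projects to `c w` on the arriving line. [cite: DuminilCopinHonglerNolin2011, §3.1, proof of Proposition 8] -/
theorem projLine_blackPhantom_self : projLine w (blackPhantom c w) = (c : ℂ) * w := by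
  rw [projLine_of_norm_eq_one hw, blackPhantom, mul_assoc, mul_assoc, mul_conj_of_norm_eq_one hw, mul_one]
  congr 1
  simp

/-- The black phantom projects to `c e^{iπ/4} w` on the line of the dart leaving after a right
turn (either orientation of that line). [cite: DuminilCopinHonglerNolin2011, §3.1, proof of Proposition 8] -/
theorem projLine_blackPhantom_turn {w' : ℂ} (hw' : w' = quarterPhase (-1) * w ∨ w' = -(quarterPhase (-1) * w)) :
    projLine w' (blackPhantom c w) = (c : ℂ) * (quarterPhase (-1) * w) := by
  have hu : ‖quarterPhase (-1) * w‖ = 1 := by rw [norm_mul, norm_quarterPhase, hw, one_mul]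
  have key : projLine (quarterPhase (-1) * w) (blackPhantom c w) = (c : ℂ) * (quarterPhase (-1) * w) := by
    rw [projLine_of_norm_eq_one hu, blackPhantom]
    congr 1
    rw [map_mul, show (c : ℂ) * (1 + ((Real.sqrt 2 - 1 : ℝ) : ℂ) * I) * w * (conj (quarterPhase (-1)) * conj w) =
      (c : ℂ) * ((1 + ((Real.sqrt 2 - 1 : ℝ) : ℂ) * I) * conj (quarterPhase (-1))) * (w * conj w) by ring,
      mul_conj_of_norm_eq_one hw, mul_one, quarterPhase_neg_one, map_div₀, map_add, map_one, conj_I, conj_ofReal]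
    have hs := sqrt_two_ne_zero'
    have hsr : Real.sqrt 2 * Real.sqrt 2 = 2 := Real.mul_self_sqrt zero_le_two
    rw [show (c : ℂ) * ((1 + ((Real.sqrt 2 - 1 : ℝ) : ℂ) * I) * ((1 + -I) / (Real.sqrt 2 : ℂ))) =
      (c : ℂ) * (((1 + ((Real.sqrt 2 - 1 : ℝ) : ℂ) * I) * (1 - I)) / (Real.sqrt 2 : ℂ)) by ring]
    rw [show (1 + ((Real.sqrt 2 - 1 : ℝ) : ℂ) * I) * (1 - I) = Real.sqrt 2 + ((Real.sqrt 2 - 2 : ℝ) : ℂ) * I by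
      push_cast; ring_nf; rw [I_sq]; ring]
    rw [show ((Real.sqrt 2 : ℂ) + ((Real.sqrt 2 - 2 : ℝ) : ℂ) * I) / (Real.sqrt 2 : ℂ) =
      1 + (((Real.sqrt 2 - 2) / Real.sqrt 2 : ℝ) : ℂ) * I by push_cast; field_simp]
    simp
  rcases hw' with rfl | rfl
  · exact key
  · rw [projLine_neg, key]

/-- The flux of the black phantom into the phantom face: `‖Proj[X; ± i w]‖² = (√2 - 1)² c²`.
[cite: DuminilCopinHonglerNolin2011, §3.1, proof of Proposition 8] -/
theorem norm_projLine_blackPhantom_perp_sq {w'' : ℂ} (hw'' : w'' = I * w ∨ w'' = -(I * w)) :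
    ‖projLine w'' (blackPhantom c w)‖ ^ 2 = (Real.sqrt 2 - 1) ^ 2 * c ^ 2 := by
  have hu : ‖I * w‖ = 1 := by rw [norm_mul, norm_I, hw, one_mul]
  have key : ‖projLine (I * w) (blackPhantom c w)‖ ^ 2 = (Real.sqrt 2 - 1) ^ 2 * c ^ 2 := by
    rw [norm_projLine_sq_of_norm_eq_one hu, blackPhantom, map_mul, conj_I,
      show (c : ℂ) * (1 + ((Real.sqrt 2 - 1 : ℝ) : ℂ) * I) * w * (-I * conj w) =
        (c : ℂ) * ((1 + ((Real.sqrt 2 - 1 : ℝ) : ℂ) * I) * (-I)) * (w * conj w) by ring,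
      mul_conj_of_norm_eq_one hw, mul_one,
      show (1 + ((Real.sqrt 2 - 1 : ℝ) : ℂ) * I) * (-I) = ((Real.sqrt 2 - 1 : ℝ) : ℂ) - I by ring_nf; rw [I_sq]; ring]
    simp; ring
  rcases hw'' with rfl | rfl
  · exact key
  · rw [projLine_neg, key]

/-- The white phantom projects to `c w` on the arriving line. [cite: DuminilCopinHonglerNolin2011, §3.1, proof of Proposition 8] -/
theorem projLine_whitePhantom_self : projLine w (whitePhantom c w) = (c : ℂ) * w := by
  rw [projLine_of_norm_eq_one hw, whitePhantom, mul_assoc, mul_assoc, mul_conj_of_norm_eq_one hw, mul_one]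
  congr 1
  simp

/-- The white phantom projects to `c e^{-iπ/4} w` on the line of the dart leaving after a left
turn (either orientation). [cite: DuminilCopinHonglerNolin2011, §3.1, proof of Proposition 8] -/
theorem projLine_whitePhantom_turn {w' : ℂ} (hw' : w' = quarterPhase 1 * w ∨ w' = -(quarterPhase 1 * w)) :
    projLine w' (whitePhantom c w) = (c : ℂ) * (quarterPhase 1 * w) := by
  have hu : ‖quarterPhase 1 * w‖ = 1 := by rw [norm_mul, norm_quarterPhase, hw, one_mul]
  have key : projLine (quarterPhase 1 * w) (whitePhantom c w) = (c : ℂ) * (quarterPhase 1 * w) := by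
    rw [projLine_of_norm_eq_one hu, whitePhantom]
    congr 1
    rw [map_mul, show (c : ℂ) * (1 - ((Real.sqrt 2 - 1 : ℝ) : ℂ) * I) * w * (conj (quarterPhase 1) * conj w) =
      (c : ℂ) * ((1 - ((Real.sqrt 2 - 1 : ℝ) : ℂ) * I) * conj (quarterPhase 1)) * (w * conj w) by ring,
      mul_conj_of_norm_eq_one hw, mul_one, quarterPhase_one, map_div₀, map_sub, map_one, conj_I, conj_ofReal]
    have hs := sqrt_two_ne_zero'
    rw [show (c : ℂ) * ((1 - ((Real.sqrt 2 - 1 : ℝ) : ℂ) * I) * ((1 - -I) / (Real.sqrt 2 : ℂ))) =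
      (c : ℂ) * (((1 - ((Real.sqrt 2 - 1 : ℝ) : ℂ) * I) * (1 + I)) / (Real.sqrt 2 : ℂ)) by ring]
    rw [show (1 - ((Real.sqrt 2 - 1 : ℝ) : ℂ) * I) * (1 + I) = Real.sqrt 2 + ((2 - Real.sqrt 2 : ℝ) : ℂ) * I by
      push_cast; ring_nf; rw [I_sq]; ring]
    rw [show ((Real.sqrt 2 : ℂ) + ((2 - Real.sqrt 2 : ℝ) : ℂ) * I) / (Real.sqrt 2 : ℂ) =
      1 + (((2 - Real.sqrt 2) / Real.sqrt 2 : ℝ) : ℂ) * I by push_cast; field_simp]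
    simp
  rcases hw' with rfl | rfl
  · exact key
  · rw [projLine_neg, key]

/-- The flux of the white phantom into the phantom square: `‖Proj[X; ± i w]‖² = (√2 - 1)² c²`.
[cite: DuminilCopinHonglerNolin2011, §3.1, proof of Proposition 8] -/
theorem norm_projLine_whitePhantom_perp_sq {w'' : ℂ} (hw'' : w'' = I * w ∨ w'' = -(I * w)) :
    ‖projLine w'' (whitePhantom c w)‖ ^ 2 = (Real.sqrt 2 - 1) ^ 2 * c ^ 2 := by
  have hu : ‖I * w‖ = 1 := by rw [norm_mul, norm_I, hw, one_mul]
  have key : ‖projLine (I * w) (whitePhantom c w)‖ ^ 2 = (Real.sqrt 2 - 1) ^ 2 * c ^ 2 := by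
    rw [norm_projLine_sq_of_norm_eq_one hu, whitePhantom, map_mul, conj_I,
      show (c : ℂ) * (1 - ((Real.sqrt 2 - 1 : ℝ) : ℂ) * I) * w * (-I * conj w) =
        (c : ℂ) * ((1 - ((Real.sqrt 2 - 1 : ℝ) : ℂ) * I) * (-I)) * (w * conj w) by ring,
      mul_conj_of_norm_eq_one hw, mul_one,
      show (1 - ((Real.sqrt 2 - 1 : ℝ) : ℂ) * I) * (-I) = -((Real.sqrt 2 - 1 : ℝ) : ℂ) - I by ring_nf; rw [I_sq]; ring]
    simp; ring
  rcases hw'' with rfl | rfl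
  · exact key
  · rw [projLine_neg, key]

end Phantom

/-! ### The sides of a face -/

/-- The four sides of a face are four distinct lattice edges. [folklore] -/
theorem cSrc_face_corner_injective (f : Site 2) :
    Function.Injective fun j : Fin 4 => cSrc (f + cornerOff j, j) := by
  have hmap : ∀ j : Fin 4, cSrc (f + cornerOff j, j) = Sym2.map (fun x => f + x) s(cornerOff j, cornerOff j + cornerUnit j) := by
    intro j; simp [cSrc, add_assoc]
  have hinj : Function.Injective (Sym2.map fun x : Site 2 => f + x) := Sym2.map.injective (add_right_injective f)
  have key : ∀ i j : Fin 4, s(cornerOff i, cornerOff i + cornerUnit i) = s(cornerOff j, cornerOff j + cornerUnit j) → i = j := by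
    decide
  intro i j h
  simp only [hmap] at h
  exact key i j (hinj h)

/-- `cornerOff (j + 1) + cornerUnit (j + 2) = cornerOff j`: following the open side `E_j` from the
corner `j + 1` of a face lands at its corner `j`. [folklore] -/
theorem cornerOff_succ_add_cornerUnit_add_two (j : Fin 4) : cornerOff (j + 1) + cornerUnit (j + 2) = cornerOff j := by
  fin_cases j <;> decide

/-! ### The black phantom trick: faces with sides on the wired arc -/

section Black

variable {E : DiscreteDobrushin}

/-- **Duminil-Copin–Hongler–Nolin's modified Laplacian, black squares (faces), for the FK
primitive.** Let `(Hw, Hb)` have the primitive property `Hb - Hw = |F(·)|²` at the darts of the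
inner face `f` and at the darts arriving at its interior sides, and let every side of `f` be either
interior (`IsInteriorEdge`) or an `A`–`A` edge of `Ω_δ` (both endpoints on the wired arc; the set
`P` of such sides). Then
`∑_{j ∉ P} (Hb(f_j) - Hb(f)) - (1 - tan²(π/8)) ∑_{j ∈ P} (Hb(f) - Hw(a_j)) ≥ 0`,
`f_j` the face across the `j`-th side, `a_j` its corner on the wired arc, `tan²(π/8) = (√2-1)²`:
the value of `Hb` across a wired boundary side may be replaced by the phantom value
`Hw(a_j) + tan²(π/8) (Hb(f) - Hw(a_j))`, Smirnov's Appendix C computation applying verbatim to the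
observable extended by the phantom vectors `blackPhantom` at the wired sides ("`H̃` satisfies the
same relation (def_H) for `e₃` and `e₄` as inside the domain … Proposition 6 applies at `B`",
eq. (modified_laplacian), here in its dual form at the wired arc).
[cite: DuminilCopinHonglerNolin2011, §3.1, Proposition 8 and eq. (modified_laplacian)] -/
theorem phantom_laplacian_hb (hE : E.IsZdAdmissible) [Fintype (meshDomain E.Ω E.δ)]
    (hA : ((discreteDomainGraph E.Ω E.δ).induce E.zdArcA).Preconnected) {Hw Hb : Site 2 → ℝ} (f : Site 2)
    (hf : E.IsInnerFace f) (P : Finset (Fin 4))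
    (hint : ∀ j, j ∉ P → E.IsInteriorEdge (f + cornerOff j) j)
    (hph : ∀ j ∈ P, f + cornerOff j ∈ E.zdArcA ∧ f + cornerOff j + cornerUnit j ∈ E.zdArcA)
    (hpair : ∀ j : Fin 4, Hb f - Hw (f + cornerOff j) = dartFlux E hE (f + cornerOff j, j))
    (hpair' : ∀ j, j ∉ P → Hb (f + cornerUnit (j + 3)) - Hw (f + cornerOff j) = dartFlux E hE (f + cornerOff j, j + 3)) :
    0 ≤ ∑ j ∈ univ.filter (· ∉ P), (Hb (f + cornerUnit (j + 3)) - Hb f) -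
      (1 - (Real.sqrt 2 - 1) ^ 2) * ∑ j ∈ P, (Hb f - Hw (f + cornerOff j)) := by
  classical
  set c₀ := DiscreteDobrushin.startCorner hE with hc₀
  set F : MedialVertex → ℂ := fkIsingObservable E criticalFKIsingParam with hFdef
  -- sides, corners, in-darts
  set Es : Fin 4 → MedialVertex := fun j => cSrc (f + cornerOff j, j) with hEs
  have hkr : ((eighthPhase 1).re : ℝ) ≠ 0 := by
    have := kappa_ne_zero; rw [kappa_eq_re] at this; exact_mod_cast this
  -- the in-dart at the side `j` inside `f` is the corner `j + 1`; its line and real coefficient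
  have hline : ∀ j : Fin 4, ∃ s : ℝ, dartObs E hE (f + cornerOff (j + 1), j + 1) =
      s * quarterPhase (dartDir c₀ (f + cornerOff (j + 1), j + 1)) := fun j => dartObs_mem_line hE _
  choose s hs using hline
  set w : Fin 4 → ℂ := fun j => quarterPhase (dartDir c₀ (f + cornerOff (j + 1), j + 1)) with hw
  have hwn : ∀ j, ‖w j‖ = 1 := fun j => norm_quarterPhase _
  set X : Fin 4 → ℂ := fun j => blackPhantom (((eighthPhase 1).re)⁻¹ * s j) (w j) with hX
  set Y : Fin 4 → ℂ := fun j => if j ∈ P then X j else F (Es j) with hY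
  set F' : MedialVertex → ℂ :=
    Function.update (Function.update (Function.update (Function.update F (Es 0) (Y 0)) (Es 1) (Y 1)) (Es 2) (Y 2)) (Es 3) (Y 3)
    with hF'
  have hinj := cSrc_face_corner_injective f
  have hF'E : ∀ j, F' (Es j) = Y j := by
    intro j
    fin_cases j
    · show F' (Es 0) = Y 0
      rw [hF', Function.update_of_ne (hinj.ne (by decide)), Function.update_of_ne (hinj.ne (by decide)),
        Function.update_of_ne (hinj.ne (by decide)), Function.update_self]
    · show F' (Es 1) = Y 1
      rw [hF', Function.update_of_ne (hinj.ne (by decide)), Function.update_of_ne (hinj.ne (by decide)),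
        Function.update_self]
    · show F' (Es 2) = Y 2
      rw [hF', Function.update_of_ne (hinj.ne (by decide)), Function.update_self]
    · show F' (Es 3) = Y 3
      rw [hF', Function.update_self]
  set G : MedialVertex → ℂ := fun z => refPhase c₀ * F' z with hG
  -- index bookkeeping
  have i13 : ∀ j : Fin 4, j + 1 + 3 = j := fun j => by omega
  have i31 : ∀ j : Fin 4, j + 3 + 1 = j := fun j => by omega
  have hcorner : ∀ j : Fin 4, (f + cornerOff (j + 1) + cornerUnit (j + 1 + 1), j + 1 + 3) = ((f + cornerOff j, j) : Site 2 × Fin 4) := by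
    intro j
    rw [Prod.mk.injEq]
    exact ⟨by rw [show j + 1 + 1 = j + 2 by omega, add_assoc, cornerOff_succ_add_cornerUnit_add_two], i13 j⟩
  -- the followed-open relation at a wired side: `dartObs (corner j) = e^{iπ/4} dartObs (corner j+1)`
  have hfollow : ∀ j ∈ P, dartObs E hE (f + cornerOff j, j) = quarterPhase (-1) * dartObs E hE (f + cornerOff (j + 1), j + 1) := by
    intro j hj
    have hqf : E.IsInnerFace (cFace ((f + cornerOff (j + 1), j + 1) : Site 2 × Fin 4)) := by rw [cFace_face_corner]; exact hf
    have htgt : cTgt ((f + cornerOff (j + 1), j + 1) : Site 2 × Fin 4) = Es j := cTgt_face_corner f (i13 j).symm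
    have hopen : ∀ ω : Percolation.BondConfig (Site 2), cTgt ((f + cornerOff (j + 1), j + 1) : Site 2 × Fin 4) ∈ E.bcBondConfig ω := by
      rw [htgt]
      have hadj : (discreteDomainGraph E.Ω E.δ).Adj (f + cornerOff j) (f + cornerOff j + cornerUnit j) :=
        DiscreteDobrushin.adj_of_isInnerFace_faceAt (j := j) (by
          change E.IsInnerFace (cFace ((f + cornerOff j, j) : Site 2 × Fin 4)); rw [cFace_face_corner]; exact hf) (Or.inl rfl)
      refine forall_mem_bcBondConfig_of_arcA ((SimpleGraph.mem_edgeSet _).2 hadj) ?_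
      intro x hx
      simp only [hEs, cSrc, Sym2.mem_iff] at hx
      rcases hx with rfl | rfl
      · exact (hph j hj).1
      · exact (hph j hj).2
    have := dartObs_follow_of_forall_mem hE hqf hopen
    rwa [hcorner j] at this
  -- source projection identity at every side
  have hsrc : ∀ j : Fin 4, projLine (quarterPhase (dartDir c₀ (f + cornerOff j, j))) (F' (Es j)) =
      (((eighthPhase 1).re)⁻¹ : ℝ) * dartObs E hE (f + cornerOff j, j) := by
    intro j
    rw [hF'E]
    by_cases hj : j ∈ P
    · simp only [hY, if_pos hj, hX]
      rcases quarterPhase_dartDir_add_three c₀ (f + cornerOff (j + 1), j + 1) (f + cornerOff j, j) (i13 j).symm with h3 | h3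
      · rw [projLine_blackPhantom_turn (hwn j) _ (Or.inl h3), hfollow j hj, hs j]; push_cast; ring
      · rw [projLine_blackPhantom_turn (hwn j) _ (Or.inr h3), hfollow j hj, hs j]; push_cast; ring
    · simp only [hY, if_neg hj]
      exact projLine_cSrc_free hE hA (hint j hj)
  -- target projection identity: the corner `j` of `f` ends at the side `j + 3`
  have htgtE : ∀ j : Fin 4, cTgt ((f + cornerOff j, j) : Site 2 × Fin 4) = Es (j + 3) := fun j => cTgt_face_corner f rfl
  have htgt : ∀ j : Fin 4, projLine (quarterPhase (dartDir c₀ (f + cornerOff j, j))) (F' (Es (j + 3))) =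
      (((eighthPhase 1).re)⁻¹ : ℝ) * dartObs E hE (f + cornerOff j, j) := by
    intro j
    rw [hF'E]
    by_cases hj : j + 3 ∈ P
    · simp only [hY, if_pos hj, hX]
      have e : ((f + cornerOff (j + 3 + 1), j + 3 + 1) : Site 2 × Fin 4) = (f + cornerOff j, j) := by rw [i31]
      simp only [hw, e]
      rw [projLine_blackPhantom_self (by rw [← e]; exact hwn (j + 3))]
      have := hs (j + 3)
      rw [e] at this
      rw [this]; push_cast; ring
    · simp only [hY, if_neg hj]
      have hside : E.IsInteriorEdge (f + cornerOff j) (j + 1) := by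
        have h := (hint (j + 3) hj).reverse
        rw [add_assoc, cornerOff_add_three_add_cornerUnit, show j + 3 + 2 = j + 1 by omega] at h
        exact h
      have := projLine_cTgt_free hE hA (p := (f + cornerOff j, j)) hside
      rwa [htgtE] at this
  -- s-holomorphicity of `G` at the four corners of `f`
  have hshol : ∀ j : Fin 4, IsSHolAt G (f + cornerOff j, j) := by
    intro j
    show projLine (cornerLine ((f + cornerOff j, j) : Site 2 × Fin 4).1 (cFace ((f + cornerOff j, j) : Site 2 × Fin 4)))
        (refPhase c₀ * F' (cSrc (f + cornerOff j, j))) =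
      projLine (cornerLine ((f + cornerOff j, j) : Site 2 × Fin 4).1 (cFace ((f + cornerOff j, j) : Site 2 × Fin 4)))
        (refPhase c₀ * F' (cTgt (f + cornerOff j, j)))
    rw [projLine_cornerLine_refPhase, projLine_cornerLine_refPhase, htgtE j]
    congr 1
    exact (hsrc j).trans (htgt j).symm
  -- inner fluxes
  have hflux_in : ∀ j : Fin 4, dartFlux E hE (f + cornerOff j, j) = fluxConst c₀ * cornerFlux G (f + cornerOff j, j) := by
    intro j
    rw [dartFlux_eq_of_projLine hE (hsrc j)]
    rfl
  -- outer fluxes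
  have hflux_out_int : ∀ j, j ∉ P → dartFlux E hE (f + cornerOff j, j + 3) = fluxConst c₀ *
      ‖projLine (cornerLine (f + cornerOff j) (faceAt (f + cornerOff j) (j + 3))) (G (Es j))‖ ^ 2 := by
    intro j hj
    have h := dartFlux_eq_target hE hA (p := (f + cornerOff j, j + 3)) (by rw [i31]; exact hint j hj)
    rw [cTgt_add_three] at h
    rw [h]
    congr 2
    simp only [hG, hF'E, hY, if_neg hj]
    rfl
  have hflux_out_ph : ∀ j ∈ P, fluxConst c₀ *
      ‖projLine (cornerLine (f + cornerOff j) (faceAt (f + cornerOff j) (j + 3))) (G (Es j))‖ ^ 2 =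
        (Real.sqrt 2 - 1) ^ 2 * dartFlux E hE (f + cornerOff j, j) := by
    intro j hj
    simp only [hG, hF'E, hY, if_pos hj]
    have hl : cornerLine (f + cornerOff j) (faceAt (f + cornerOff j) (j + 3)) =
        cornerLine ((f + cornerOff j, j + 3) : Site 2 × Fin 4).1 (cFace ((f + cornerOff j, j + 3) : Site 2 × Fin 4)) := rfl
    rw [hl, projLine_cornerLine_refPhase, norm_mul, mul_pow]
    rcases quarterPhase_dartDir_add_two c₀ (f + cornerOff (j + 1), j + 1) (f + cornerOff j, j + 3)
      (by simp only; omega) with h2 | h2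
    · rw [h2, hX, norm_projLine_blackPhantom_perp_sq (hwn j) _ (Or.inl rfl)]
      rw [dartFlux, hfollow j hj, hs j, norm_mul, norm_mul, norm_quarterPhase, norm_quarterPhase, Complex.norm_real,
        Real.norm_eq_abs, one_mul, mul_one, sq_abs, fluxConst]
      have hR : ‖refPhase c₀‖ ≠ 0 := norm_ne_zero_iff.2 (refPhase_ne_zero c₀)
      field_simp
    · rw [h2, hX, norm_projLine_blackPhantom_perp_sq (hwn j) _ (Or.inr rfl)]
      rw [dartFlux, hfollow j hj, hs j, norm_mul, norm_mul, norm_quarterPhase, norm_quarterPhase, Complex.norm_real,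
        Real.norm_eq_abs, one_mul, mul_one, sq_abs, fluxConst]
      have hR : ‖refPhase c₀‖ ≠ 0 := norm_ne_zero_iff.2 (refPhase_ne_zero c₀)
      field_simp
  -- Appendix C for `G`
  have key := sum_faceStep_eq_norm_sq' G f hshol
  have hpos : 0 ≤ fluxConst c₀ * ∑ j : Fin 4,
      (‖projLine (cornerLine (f + cornerOff j) (faceAt (f + cornerOff j) (j + 3))) (G (cSrc (f + cornerOff j, j)))‖ ^ 2 -
        cornerFlux G (f + cornerOff j, j)) := by
    rw [key]; exact mul_nonneg (fluxConst_pos c₀).le (sq_nonneg _)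
  -- translate term by term
  have hterm : ∀ j : Fin 4, fluxConst c₀ *
      (‖projLine (cornerLine (f + cornerOff j) (faceAt (f + cornerOff j) (j + 3))) (G (cSrc (f + cornerOff j, j)))‖ ^ 2 -
        cornerFlux G (f + cornerOff j, j)) =
      (if j ∈ P then -((1 - (Real.sqrt 2 - 1) ^ 2) * (Hb f - Hw (f + cornerOff j)))
        else Hb (f + cornerUnit (j + 3)) - Hb f) := by
    intro j
    rw [mul_sub, ← hflux_in j]
    by_cases hj : j ∈ P
    · rw [if_pos hj, show cSrc (f + cornerOff j, j) = Es j from rfl, hflux_out_ph j hj, ← hpair j]; ring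
    · rw [if_neg hj, show cSrc (f + cornerOff j, j) = Es j from rfl, ← hflux_out_int j hj, ← hpair j, ← hpair' j hj]; ring
  rw [Finset.mul_sum, Finset.sum_congr rfl fun j _ => hterm j, Finset.sum_ite] at hpos
  rw [Finset.sum_neg_distrib, ← Finset.mul_sum] at hpos
  have hPf : univ.filter (fun j => j ∈ P) = P := by ext j; simp
  rw [hPf] at hpos
  linarith

end Black

/-! ### The white phantom trick: sites next to the free arc -/

section White

variable {E : DiscreteDobrushin}

/-- **Duminil-Copin–Hongler–Nolin's modified Laplacian, white squares (sites), for the FK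
primitive** — eq. (modified_laplacian) in the tree's rendering (`H_• = 1 - Hw`, the extra layer
of black faces along the free arc being the arc `B` itself). Let the four faces at the site `u` be
inner, `(Hw, Hb)` have the primitive property at the darts of `u` and at the darts arriving at its
edges, and let every edge `e_k` at `u` be either interior or lead to a site `u + e_k` of the arc
`B` (the set `P` of such directions). Then
`∑_{k ∉ P} (Hw(u + e_k) - Hw(u)) + (1 - tan²(π/8)) ∑_{k ∈ P} (Hw(u + e_k) - Hw(u)) ≤ 0`:
`Hw` is superharmonic at `u` for the nearest-neighbour operator with weight `1` towards ordinary
neighbours and weight `1 - tan²(π/8) = 2(√2 - 1)` towards the arc `B` — DCHN's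
`(2+√2)/(6+5√2) [H(B_W)+H(B_N)+H(B_E)] + (2√2)/(6+5√2) H(B_S) - H(B) ≥ 0` for `H = 1 - Hw`,
`|P| = 1`, after normalisation. The phantom value replacing `Hw(b)` across a free boundary edge is
`Hw(b) - tan²(π/8) (Hw(b) - Hw(u))` ("`H̃(B_S) = tan²(π/8) H(B)`").
[cite: DuminilCopinHonglerNolin2011, §3.1, Proposition 8 and eq. (modified_laplacian)] -/
theorem phantom_laplacian_hw (hE : E.IsZdAdmissible) [Fintype (meshDomain E.Ω E.δ)]
    (hA : ((discreteDomainGraph E.Ω E.δ).induce E.zdArcA).Preconnected) {Hw Hb : Site 2 → ℝ} (u : Site 2)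
    (hfaces : ∀ k : Fin 4, E.IsInnerFace (faceAt u k)) (P : Finset (Fin 4))
    (hint : ∀ k, k ∉ P → E.IsInteriorEdge u k) (hph : ∀ k ∈ P, u + cornerUnit k ∈ E.zdArcB)
    (hpair : ∀ k : Fin 4, Hb (faceAt u k) - Hw u = dartFlux E hE (u, k))
    (hpair' : ∀ k : Fin 4, Hb (faceAt u k) - Hw (u + cornerUnit k) = dartFlux E hE (u + cornerUnit k, k + 1)) :
    ∑ k ∈ univ.filter (· ∉ P), (Hw (u + cornerUnit k) - Hw u) +
      (1 - (Real.sqrt 2 - 1) ^ 2) * ∑ k ∈ P, (Hw (u + cornerUnit k) - Hw u) ≤ 0 := by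
  classical
  set c₀ := DiscreteDobrushin.startCorner hE with hc₀
  set F : MedialVertex → ℂ := fkIsingObservable E criticalFKIsingParam with hFdef
  set Es : Fin 4 → MedialVertex := fun k => cSrc (u, k) with hEs
  -- the in-dart at the edge `e_k` around `u` is the corner `(u, k + 3)`
  have hline : ∀ k : Fin 4, ∃ s : ℝ, dartObs E hE (u, k + 3) = s * quarterPhase (dartDir c₀ (u, k + 3)) :=
    fun k => dartObs_mem_line hE _
  choose s hs using hline
  set w : Fin 4 → ℂ := fun k => quarterPhase (dartDir c₀ (u, k + 3)) with hw
  have hwn : ∀ k, ‖w k‖ = 1 := fun k => norm_quarterPhase _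
  set X : Fin 4 → ℂ := fun k => whitePhantom (((eighthPhase 1).re)⁻¹ * s k) (w k) with hX
  set Y : Fin 4 → ℂ := fun k => if k ∈ P then X k else F (Es k) with hY
  set F' : MedialVertex → ℂ :=
    Function.update (Function.update (Function.update (Function.update F (Es 0) (Y 0)) (Es 1) (Y 1)) (Es 2) (Y 2)) (Es 3) (Y 3)
    with hF'
  have hinj : Function.Injective Es := by
    intro i j h
    simp only [hEs, cSrc, Sym2.eq_iff, true_and] at h
    rcases h with h | ⟨h1, -⟩
    · exact cornerUnit_injective (add_left_cancel h)
    · exfalso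
      have := congrArg (fun x => x - u) h1
      simp only [add_sub_cancel_left, sub_self] at this
      exact cornerUnit_ne_zero _ this.symm
  have hF'E : ∀ k, F' (Es k) = Y k := by
    intro k
    fin_cases k
    · show F' (Es 0) = Y 0
      rw [hF', Function.update_of_ne (hinj.ne (by decide)), Function.update_of_ne (hinj.ne (by decide)),
        Function.update_of_ne (hinj.ne (by decide)), Function.update_self]
    · show F' (Es 1) = Y 1
      rw [hF', Function.update_of_ne (hinj.ne (by decide)), Function.update_of_ne (hinj.ne (by decide)),
        Function.update_self]
    · show F' (Es 2) = Y 2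
      rw [hF', Function.update_of_ne (hinj.ne (by decide)), Function.update_self]
    · show F' (Es 3) = Y 3
      rw [hF', Function.update_self]
  set G : MedialVertex → ℂ := fun z => refPhase c₀ * F' z with hG
  have i31 : ∀ k : Fin 4, k + 3 + 1 = k := fun k => by omega
  have i13 : ∀ k : Fin 4, k + 1 + 3 = k := fun k => by omega
  -- the crossed-closed relation at a free edge: `dartObs (u, k) = e^{-iπ/4} dartObs (u, k + 3)`
  have hcross : ∀ k ∈ P, dartObs E hE (u, k) = quarterPhase 1 * dartObs E hE (u, k + 3) := by
    intro k hk
    have hclosed : ∀ ω : Percolation.BondConfig (Site 2), cTgt ((u, k + 3) : Site 2 × Fin 4) ∉ E.bcBondConfig ω := by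
      rw [cTgt_add_three]
      exact forall_not_mem_bcBondConfig_of_arcB hE (Sym2.mem_mk_right _ _) (hph k hk)
    have h := dartObs_cross_of_forall_not_mem hE (q := (u, k + 3)) (hfaces (k + 3)) (by rw [i31]; exact hfaces k) hclosed
    simp only [i31] at h
    exact h
  -- source identity at every edge
  have hsrc : ∀ k : Fin 4, projLine (quarterPhase (dartDir c₀ (u, k))) (F' (Es k)) =
      (((eighthPhase 1).re)⁻¹ : ℝ) * dartObs E hE (u, k) := by
    intro k
    rw [hF'E]
    by_cases hk : k ∈ P
    · simp only [hY, if_pos hk, hX]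
      rcases quarterPhase_dartDir_add_one c₀ (u, k + 3) (u, k) (i31 k).symm with h1 | h1
      · rw [projLine_whitePhantom_turn (hwn k) _ (Or.inl h1), hcross k hk, hs k]; push_cast; ring
      · rw [projLine_whitePhantom_turn (hwn k) _ (Or.inr h1), hcross k hk, hs k]; push_cast; ring
    · simp only [hY, if_neg hk]
      exact projLine_cSrc_free hE hA (hint k hk)
  -- target identity: the corner `(u, k)` ends at the edge `e_{k+1}`
  have htgtE : ∀ k : Fin 4, cTgt ((u, k) : Site 2 × Fin 4) = Es (k + 1) := fun k => rfl
  have htgt : ∀ k : Fin 4, projLine (quarterPhase (dartDir c₀ (u, k))) (F' (Es (k + 1))) =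
      (((eighthPhase 1).re)⁻¹ : ℝ) * dartObs E hE (u, k) := by
    intro k
    rw [hF'E]
    by_cases hk : k + 1 ∈ P
    · simp only [hY, if_pos hk, hX]
      have e : ((u, k + 1 + 3) : Site 2 × Fin 4) = (u, k) := by rw [i13]
      simp only [hw, e]
      rw [projLine_whitePhantom_self (by rw [← e]; exact hwn (k + 1))]
      have := hs (k + 1)
      rw [e] at this
      rw [this]; push_cast; ring
    · simp only [hY, if_neg hk]
      exact projLine_cTgt_free hE hA (p := (u, k)) (hint (k + 1) hk)
  -- s-holomorphicity of `G` at the four corners of `u`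
  have hshol : ∀ k : Fin 4, IsSHolAt G (u, k) := by
    intro k
    show projLine (cornerLine ((u, k) : Site 2 × Fin 4).1 (cFace ((u, k) : Site 2 × Fin 4))) (refPhase c₀ * F' (cSrc (u, k))) =
      projLine (cornerLine ((u, k) : Site 2 × Fin 4).1 (cFace ((u, k) : Site 2 × Fin 4))) (refPhase c₀ * F' (cTgt (u, k)))
    rw [projLine_cornerLine_refPhase, projLine_cornerLine_refPhase, htgtE k]
    congr 1
    exact (hsrc k).trans (htgt k).symm
  -- inner fluxes
  have hflux_in : ∀ k : Fin 4, dartFlux E hE (u, k) = fluxConst c₀ * cornerFlux G (u, k) := by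
    intro k
    rw [dartFlux_eq_of_projLine hE (hsrc k)]
    rfl
  -- outer fluxes, interior edges
  have hflux_out_int : ∀ k, k ∉ P → dartFlux E hE (u + cornerUnit k, k + 1) = fluxConst c₀ *
      ‖projLine (cornerLine (u + cornerUnit k) (faceAt (u + cornerUnit k) (k + 1))) (G (Es k))‖ ^ 2 := by
    intro k hk
    have h := dartFlux_eq_target hE hA (p := (u + cornerUnit k, k + 1))
      (by simp only [show k + 1 + 1 = k + 2 by omega]; exact (hint k hk).reverse)
    rw [cTgt_add_cornerUnit_succ] at h
    rw [h]
    congr 2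
    simp only [hG, hF'E, hY, if_neg hk]
    rfl
  -- outer fluxes, phantom edges
  have hflux_out_ph : ∀ k ∈ P, fluxConst c₀ *
      ‖projLine (cornerLine (u + cornerUnit k) (faceAt (u + cornerUnit k) (k + 1))) (G (Es k))‖ ^ 2 =
        (Real.sqrt 2 - 1) ^ 2 * dartFlux E hE (u, k) := by
    intro k hk
    simp only [hG, hF'E, hY, if_pos hk]
    have hl : cornerLine (u + cornerUnit k) (faceAt (u + cornerUnit k) (k + 1)) =
        cornerLine ((u + cornerUnit k, k + 1) : Site 2 × Fin 4).1 (cFace ((u + cornerUnit k, k + 1) : Site 2 × Fin 4)) := rfl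
    rw [hl, projLine_cornerLine_refPhase, norm_mul, mul_pow]
    have hR : ‖refPhase c₀‖ ≠ 0 := norm_ne_zero_iff.2 (refPhase_ne_zero c₀)
    have hkr : ((eighthPhase 1).re : ℝ) ≠ 0 := by
      have := kappa_ne_zero; rw [kappa_eq_re] at this; exact_mod_cast this
    rcases quarterPhase_dartDir_add_two c₀ (u, k + 3) (u + cornerUnit k, k + 1) (by simp only; omega) with h2 | h2
    · rw [h2, hX, norm_projLine_whitePhantom_perp_sq (hwn k) _ (Or.inl rfl)]
      rw [dartFlux, hcross k hk, hs k, norm_mul, norm_mul, norm_quarterPhase, norm_quarterPhase, Complex.norm_real,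
        Real.norm_eq_abs, one_mul, mul_one, sq_abs, fluxConst]
      field_simp
    · rw [h2, hX, norm_projLine_whitePhantom_perp_sq (hwn k) _ (Or.inr rfl)]
      rw [dartFlux, hcross k hk, hs k, norm_mul, norm_mul, norm_quarterPhase, norm_quarterPhase, Complex.norm_real,
        Real.norm_eq_abs, one_mul, mul_one, sq_abs, fluxConst]
      field_simp
  -- no flux at the free arc: `Hb (faceAt u k) = Hw (u + e_k)` for `k ∈ P`
  have hB : ∀ k ∈ P, Hb (faceAt u k) = Hw (u + cornerUnit k) := by
    intro k hk
    have h := hpair' k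
    rw [dartFlux_eq_zero_of_mem_zdArcB hE (q := (u + cornerUnit k, k + 1)) (hph k hk)] at h
    linarith
  -- Appendix C for `G`
  have key := sum_vertexStep_eq_neg_norm_sq' G u hshol
  have hneg : fluxConst c₀ * ∑ k : Fin 4, (cornerFlux G (u, k) -
      ‖projLine (cornerLine (u + cornerUnit k) (faceAt (u + cornerUnit k) (k + 1))) (G (cSrc (u, k)))‖ ^ 2) ≤ 0 := by
    rw [key]
    exact mul_nonpos_of_nonneg_of_nonpos (fluxConst_pos c₀).le (neg_nonpos.2 (sq_nonneg _))
  have hterm : ∀ k : Fin 4, fluxConst c₀ * (cornerFlux G (u, k) -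
      ‖projLine (cornerLine (u + cornerUnit k) (faceAt (u + cornerUnit k) (k + 1))) (G (cSrc (u, k)))‖ ^ 2) =
      (if k ∈ P then (1 - (Real.sqrt 2 - 1) ^ 2) * (Hw (u + cornerUnit k) - Hw u)
        else Hw (u + cornerUnit k) - Hw u) := by
    intro k
    rw [mul_sub, ← hflux_in k]
    by_cases hk : k ∈ P
    · rw [if_pos hk, show cSrc (u, k) = Es k from rfl, hflux_out_ph k hk, ← hpair k, hB k hk]; ring
    · rw [if_neg hk, show cSrc (u, k) = Es k from rfl, ← hflux_out_int k hk, ← hpair k, ← hpair' k]; ring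
  rw [Finset.mul_sum, Finset.sum_congr rfl fun k _ => hterm k, Finset.sum_ite, ← Finset.mul_sum] at hneg
  have hPf : univ.filter (fun k => k ∈ P) = P := by ext k; simp
  rw [hPf] at hneg
  linarith

end White

end Literature.Probability.LatticeModels
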